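import Mathlib
import HarnessLib
import Summits.PneNP.PneNP.Theorems.CnfIdealGenLengthRankDefectRepresentationsMergeLowerBound

/-!
# Intertwiners: idempotents of equal rank at rank-distance `t` are conjugate by `1 + (rank ≤ 2t)` (crux
# `RankDefectRepresentations` = stmt-PneNP-18923, line `cell-union-merge`; lead g18)

The transport step used (on paper) throughout the line — memo g17 §4b(i) "conjugation form", memo g18 §7/§9 (decoupling;
the route to AMB with `λ(c) = 2^{O(c)}`) — as a kernel tool:

  `exists_intertwiner` — if `E, F` are idempotent `d × d` matrices over a field with `rank E = rank F`, then there are mutually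
  inverse `S, T` with `S E = F S` (so `F = S E T`) and `rank (S − 1) ≤ 2 · rank (E − F)`.

Proof: `S` is the identity on `im E ∩ im F` and on `ker E ∩ ker F` and maps complements of these inside `im E`, `ker E`
isomorphically onto complements inside `im F`, `ker F` (dimensions agree because `rank E = rank F`); `im E ∩ im F` has
codimension `≤ rank (E − F)` in `im E` (`im E ⊆ im F + im (E − F)`), likewise for kernels.
HONEST FRAMING: linear-algebra tool in the negative lane; nothing here bears on the crux directly; P ≠ NP is not moved;
F-N2 is a FRONTIER formal rung.
-/

set_option linter.dupNamespace false -- `Summit.PneNP.PneNP.…`: summit = sub-problem name (D-0017)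

namespace Summit.PneNP.PneNP.Theorems.CnfIdealGenLengthRankDefectRepresentationsIntertwiner

open Module Submodule

section LinearMaps

variable {K : Type} [Field K] {V : Type} [AddCommGroup V] [Module K V] [FiniteDimensional K V]

/-- Inside a finite-dimensional space: an isomorphism between two subspaces `P, P'` of equal dimension that is the identity on
a common subspace `A ≤ P ⊓ P'`. [folklore] -/
theorem exists_equiv_fixing (P P' A : Submodule K V) (hA : A ≤ P) (hA' : A ≤ P') (h : finrank K P = finrank K P') :
    ∃ φ : P ≃ₗ[K] P', ∀ (v : P), (v : V) ∈ A → (φ v : V) = v := by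
  -- `A` seen inside `P` and inside `P'`, with complements
  let AP : Submodule K P := A.comap P.subtype
  let AP' : Submodule K P' := A.comap P'.subtype
  obtain ⟨C, hC⟩ := AP.exists_isCompl
  obtain ⟨C', hC'⟩ := AP'.exists_isCompl
  let eAP : AP ≃ₗ[K] A := Submodule.comapSubtypeEquivOfLe hA
  let eAP' : AP' ≃ₗ[K] A := Submodule.comapSubtypeEquivOfLe hA'
  have hdimC : finrank K C = finrank K C' := by
    have h1 := Submodule.finrank_add_eq_of_isCompl hC
    have h2 := Submodule.finrank_add_eq_of_isCompl hC'
    rw [eAP.finrank_eq] at h1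
    rw [eAP'.finrank_eq] at h2
    have h3 : finrank K P = finrank K P' := h
    omega
  let ψ : C ≃ₗ[K] C' := LinearEquiv.ofFinrankEq C C' hdimC
  let θ : AP ≃ₗ[K] AP' := eAP.trans eAP'.symm
  let φ : P ≃ₗ[K] P' :=
    ((Submodule.prodEquivOfIsCompl AP C hC).symm.trans (θ.prodCongr ψ)).trans (Submodule.prodEquivOfIsCompl AP' C' hC')
  refine ⟨φ, fun v hv => ?_⟩
  have hvAP : v ∈ AP := hv
  have hdec : (Submodule.prodEquivOfIsCompl AP C hC).symm v = ((⟨v, hvAP⟩ : AP), 0) :=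
    Submodule.prodEquivOfIsCompl_symm_apply_left AP C hC (⟨v, hvAP⟩ : AP)
  show ((Submodule.prodEquivOfIsCompl AP' C' hC') ((θ.prodCongr ψ) ((Submodule.prodEquivOfIsCompl AP C hC).symm v)) : V)
    = v
  rw [hdec, LinearEquiv.prodCongr_apply, map_zero, Submodule.coe_prodEquivOfIsCompl']
  simp only [Submodule.coe_zero, add_zero]
  rfl


/-- **Conjugating idempotent endomorphisms of equal rank.**  There is an automorphism `S` with `S ∘ e = f ∘ S` which is the
identity on `im e ∩ im f` and on `ker e ∩ ker f`; consequently `S − 1` has rank `≤ 2 · rank (e − f)`. [folklore] -/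
theorem exists_conj_of_idempotent (e f : Module.End K V) (he : IsIdempotentElem e) (hf : IsIdempotentElem f)
    (h : finrank K (LinearMap.range e) = finrank K (LinearMap.range f)) :
    ∃ S : V ≃ₗ[K] V, (∀ v, S (e v) = f (S v)) ∧
      finrank K (LinearMap.range ((S : V →ₗ[K] V) - LinearMap.id)) ≤ 2 * finrank K (LinearMap.range (e - f)) := by
  have hce : IsCompl (LinearMap.range e) (LinearMap.ker e) := LinearMap.IsIdempotentElem.isCompl he
  have hcf : IsCompl (LinearMap.range f) (LinearMap.ker f) := LinearMap.IsIdempotentElem.isCompl hf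
  have hker : finrank K (LinearMap.ker e) = finrank K (LinearMap.ker f) := by
    have h1 := LinearMap.finrank_range_add_finrank_ker e
    have h2 := LinearMap.finrank_range_add_finrank_ker f
    omega
  obtain ⟨φ, hφ⟩ := exists_equiv_fixing (LinearMap.range e) (LinearMap.range f)
    (LinearMap.range e ⊓ LinearMap.range f) inf_le_left inf_le_right h
  obtain ⟨ψ, hψ⟩ := exists_equiv_fixing (LinearMap.ker e) (LinearMap.ker f)
    (LinearMap.ker e ⊓ LinearMap.ker f) inf_le_left inf_le_right hker
  let S : V ≃ₗ[K] V := ((Submodule.prodEquivOfIsCompl _ _ hce).symm.trans (φ.prodCongr ψ)).trans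
    (Submodule.prodEquivOfIsCompl _ _ hcf)
  -- `S` on the two summands
  have hSa : ∀ a : LinearMap.range e, S a = φ a := by
    intro a
    show (Submodule.prodEquivOfIsCompl _ _ hcf) ((φ.prodCongr ψ) ((Submodule.prodEquivOfIsCompl _ _ hce).symm a)) = _
    rw [Submodule.prodEquivOfIsCompl_symm_apply_left _ _ hce a, LinearEquiv.prodCongr_apply, map_zero,
      Submodule.coe_prodEquivOfIsCompl']
    simp
  have hSb : ∀ b : LinearMap.ker e, S b = ψ b := by
    intro b
    show (Submodule.prodEquivOfIsCompl _ _ hcf) ((φ.prodCongr ψ) ((Submodule.prodEquivOfIsCompl _ _ hce).symm b)) = _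
    rw [Submodule.prodEquivOfIsCompl_symm_apply_right _ _ hce b, LinearEquiv.prodCongr_apply, map_zero,
      Submodule.coe_prodEquivOfIsCompl']
    simp
  have he_fix : ∀ a : LinearMap.range e, e a = a := by
    rintro ⟨a, ⟨w, rfl⟩⟩
    show e (e w) = e w
    exact LinearMap.congr_fun he w
  have hf_fix : ∀ a : LinearMap.range f, f a = a := by
    rintro ⟨a, ⟨w, rfl⟩⟩
    show f (f w) = f w
    exact LinearMap.congr_fun hf w
  refine ⟨S, fun v => ?_, ?_⟩
  · -- decompose `v = a + b`
    have hv : v ∈ LinearMap.range e ⊔ LinearMap.ker e := by rw [hce.sup_eq_top]; exact Submodule.mem_top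
    obtain ⟨a, ha, b, hb, rfl⟩ := Submodule.mem_sup.mp hv
    have hea : e a = a := he_fix ⟨a, ha⟩
    have heb : e b = 0 := hb
    rw [map_add, hea, heb, add_zero, map_add]
    have h1 : S a = φ ⟨a, ha⟩ := hSa ⟨a, ha⟩
    have h2 : S b = ψ ⟨b, hb⟩ := hSb ⟨b, hb⟩
    rw [h1, h2, map_add, hf_fix (φ ⟨a, ha⟩)]
    have : f (ψ ⟨b, hb⟩ : V) = 0 := (ψ ⟨b, hb⟩).2
    rw [this, add_zero]
  · -- rank bound: `S − 1` vanishes on `A ⊔ B`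
    set A := LinearMap.range e ⊓ LinearMap.range f with hA
    set B := LinearMap.ker e ⊓ LinearMap.ker f with hB
    set t := finrank K (LinearMap.range (e - f)) with ht
    have hAfix : ∀ v ∈ A, S v = v := by
      intro v hv
      have h1 : S v = φ ⟨v, hv.1⟩ := hSa ⟨v, hv.1⟩
      rw [h1]; exact hφ ⟨v, hv.1⟩ hv
    have hBfix : ∀ v ∈ B, S v = v := by
      intro v hv
      have h1 : S v = ψ ⟨v, hv.1⟩ := hSb ⟨v, hv.1⟩
      rw [h1]; exact hψ ⟨v, hv.1⟩ hv
    have hkerle : A ⊔ B ≤ LinearMap.ker ((S : V →ₗ[K] V) - LinearMap.id) := by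
      refine sup_le (fun v hv => ?_) (fun v hv => ?_)
      · rw [LinearMap.mem_ker, LinearMap.sub_apply, LinearMap.id_apply, LinearEquiv.coe_coe, hAfix v hv, sub_self]
      · rw [LinearMap.mem_ker, LinearMap.sub_apply, LinearMap.id_apply, LinearEquiv.coe_coe, hBfix v hv, sub_self]
    -- dimensions of `A` and `B`
    have hAdim : finrank K (LinearMap.range e) ≤ finrank K A + t := by
      have hsup : LinearMap.range e ⊔ LinearMap.range f ≤ LinearMap.range f ⊔ LinearMap.range (e - f) := by
        refine sup_le (fun v hv => ?_) le_sup_left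
        obtain ⟨w, rfl⟩ := hv
        have : e w = f w + (e - f) w := by rw [LinearMap.sub_apply]; abel
        rw [this]
        exact Submodule.add_mem_sup (LinearMap.mem_range_self f w) (LinearMap.mem_range_self _ w)
      have h1 := Submodule.finrank_sup_add_finrank_inf_eq (LinearMap.range e) (LinearMap.range f)
      have h2 := Submodule.finrank_mono hsup
      have h3 := Submodule.finrank_add_le_finrank_add_finrank (LinearMap.range f) (LinearMap.range (e - f))
      rw [← hA] at h1
      omega
    have hBdim : finrank K (LinearMap.ker e) ≤ finrank K B + t := by
      have hsup : LinearMap.ker e ⊔ LinearMap.ker f ≤ LinearMap.ker f ⊔ LinearMap.range (e - f) := by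
        refine sup_le (fun v hv => ?_) le_sup_left
        have hv' : e v = 0 := hv
        have h1 : v = (v - f v) + f v := by abel
        have h2 : v - f v ∈ LinearMap.ker f := by
          rw [LinearMap.mem_ker, map_sub]
          have : f (f v) = f v := LinearMap.congr_fun hf v
          rw [this, sub_self]
        have h3 : f v ∈ LinearMap.range (e - f) := ⟨-v, by rw [map_neg, LinearMap.sub_apply, hv']; simp⟩
        rw [h1]
        exact Submodule.add_mem_sup h2 h3
      have h1 := Submodule.finrank_sup_add_finrank_inf_eq (LinearMap.ker e) (LinearMap.ker f)
      have h2 := Submodule.finrank_mono hsup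
      have h3 := Submodule.finrank_add_le_finrank_add_finrank (LinearMap.ker f) (LinearMap.range (e - f))
      rw [← hB] at h1
      omega
    have hAB : Disjoint A B := by
      refine (hce.disjoint.mono inf_le_left inf_le_left)
    have hABdim : finrank K ↥(A ⊔ B) = finrank K A + finrank K B := by
      have := Submodule.finrank_sup_add_finrank_inf_eq A B
      rw [hAB.eq_bot, finrank_bot] at this
      omega
    have hker := Submodule.finrank_mono hkerle
    have hrk := LinearMap.finrank_range_add_finrank_ker ((S : V →ₗ[K] V) - LinearMap.id)
    have htot := LinearMap.finrank_range_add_finrank_ker e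
    have hV : finrank K V = finrank K (LinearMap.range e) + finrank K (LinearMap.ker e) := htot.symm
    rw [hABdim] at hker
    omega

end LinearMaps


section Matrices

variable {K : Type} [Field K] {d : ℕ}

/-- The rank of `toMatrix' g` is the dimension of the range of `g`. [folklore] -/
theorem rank_toMatrix' (g : (Fin d → K) →ₗ[K] (Fin d → K)) :
    (LinearMap.toMatrix' g).rank = finrank K (LinearMap.range g) := by
  have h : (LinearMap.toMatrix' g).mulVecLin = g := by
    apply LinearMap.ext; intro v
    rw [Matrix.mulVecLin_apply, ← Matrix.toLin'_apply, Matrix.toLin'_toMatrix']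
  show finrank K (LinearMap.range (LinearMap.toMatrix' g).mulVecLin) = _
  rw [h]

/-- `toMatrix'` inverts `mulVecLin`. [folklore] -/
theorem toMatrix'_mulVecLin (M : Matrix (Fin d) (Fin d) K) : LinearMap.toMatrix' M.mulVecLin = M := by
  have h : M.mulVecLin = Matrix.toLin' M := by
    apply LinearMap.ext; intro v; rw [Matrix.mulVecLin_apply, Matrix.toLin'_apply]
  rw [h, LinearMap.toMatrix'_toLin']

/-- **Intertwiner lemma (matrices).**  Idempotent matrices `E, F` of equal rank are conjugate, `F = S E T` with `S T = T S = 1`,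
`S E = F S`, and `rank (S − 1) ≤ 2 · rank (E − F)`. -/
theorem exists_intertwiner (E F : Matrix (Fin d) (Fin d) K) (hE : E * E = E) (hF : F * F = F) (hrank : E.rank = F.rank) :
    ∃ S T : Matrix (Fin d) (Fin d) K, S * T = 1 ∧ T * S = 1 ∧ S * E = F * S ∧ (S - 1).rank ≤ 2 * (E - F).rank := by
  let e : Module.End K (Fin d → K) := E.mulVecLin
  let f : Module.End K (Fin d → K) := F.mulVecLin
  have he : IsIdempotentElem e := by
    show e * e = e
    rw [Module.End.mul_eq_comp]
    show E.mulVecLin ∘ₗ E.mulVecLin = E.mulVecLin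
    rw [← Matrix.mulVecLin_mul, hE]
  have hf : IsIdempotentElem f := by
    show f * f = f
    rw [Module.End.mul_eq_comp]
    show F.mulVecLin ∘ₗ F.mulVecLin = F.mulVecLin
    rw [← Matrix.mulVecLin_mul, hF]
  have h : finrank K (LinearMap.range e) = finrank K (LinearMap.range f) := hrank
  obtain ⟨S, hSe, hSr⟩ := exists_conj_of_idempotent e f he hf h
  refine ⟨LinearMap.toMatrix' (S : (Fin d → K) →ₗ[K] (Fin d → K)),
    LinearMap.toMatrix' (S.symm : (Fin d → K) →ₗ[K] (Fin d → K)), ?_, ?_, ?_, ?_⟩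
  · rw [← LinearMap.toMatrix'_comp, ← LinearEquiv.coe_trans, LinearEquiv.symm_trans_self, LinearEquiv.refl_toLinearMap,
      LinearMap.toMatrix'_id]
  · rw [← LinearMap.toMatrix'_comp, ← LinearEquiv.coe_trans, LinearEquiv.self_trans_symm, LinearEquiv.refl_toLinearMap,
      LinearMap.toMatrix'_id]
  · have hE' : E = LinearMap.toMatrix' e := (toMatrix'_mulVecLin E).symm
    have hF' : F = LinearMap.toMatrix' f := (toMatrix'_mulVecLin F).symm
    rw [hE', hF', ← LinearMap.toMatrix'_comp, ← LinearMap.toMatrix'_comp]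
    congr 1
    apply LinearMap.ext; intro v
    exact hSe v
  · have h1 : LinearMap.toMatrix' (S : (Fin d → K) →ₗ[K] (Fin d → K)) - 1 =
        LinearMap.toMatrix' ((S : (Fin d → K) →ₗ[K] (Fin d → K)) - LinearMap.id) := by
      rw [map_sub, LinearMap.toMatrix'_id]
    have h2 : (E - F).rank = finrank K (LinearMap.range (e - f)) := by
      have : E - F = LinearMap.toMatrix' (e - f) := by
        rw [map_sub, toMatrix'_mulVecLin, toMatrix'_mulVecLin]
      rw [this, rank_toMatrix']
    rw [h1, rank_toMatrix', h2]
    exact hSr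

end Matrices

end Summit.PneNP.PneNP.Theorems.CnfIdealGenLengthRankDefectRepresentationsIntertwiner
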